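import Summits.QuantumFields.YangMills.Theorems.FlatTubeReductionSlowSideIntegrated
import HarnessLib

/-!
# The integrated slow bound SPLIT into eight fibre factors (linearity bookkeeping)

Support file for the crux `NearFlatRatioLaw` (line `ratepack_v2`, stub `stub_hODpot_A`; successor step (A) of
`Cruxes/NearFlatRatioLaw/Lines/ratepack-v7-moments-g18.md` §14; memo v8 (g19)).

`…SlowSideIntegrated.integral_weight_mul_slow_side_le` bounds the first term of the record core `L²` estimate by
`∫dπ G(v)·SB(v)`, `SB(v)` = the slow bound of `…SlowSideAssembly.slow_side_le`: a polynomial in `s_v = min(‖x_v‖², R_in²)` whose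
coefficients are the five colour-averaged central transfers `𝒴₀,…,𝒴₄(v)`, the fibre amplitude `e^{-q(x_v)}` and β-explicit scalars.
This file is PURE BOOKKEEPING, stated on an arbitrary finite measure space so that the 30-kB record expressions enter only by
instantiation: with `F₀₀ = ∫w𝒴₀`, `F₀₂ = ∫w n²𝒴₀`, `F₀₄ = ∫w n⁴𝒴₀` (`s ≤ n`, of record `n = ‖x_v‖²`), `F_i = ∫w𝒴_i`, `F_E = ∫w e^{-q}`,
* `slow_bound_mul_le_split` (§1, pure real algebra): `w·SB_num(s) ≤ Σ_t A_t·(w·mono_t)` — an IDENTITY at `s = n` (`ring`) plus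
  monotonicity in `s² ≤ n²`, `s⁴ ≤ n⁴`; the coefficients `A_t` are displayed, grouped as `(…)·‖φ‖² + (…)·∫orbitDist²φ²`;
* `integral_lin8_div` (§2): linearity of `∫` for the resulting 8-term combination;
* ★★ `integral_weight_mul_slow_bound_le_split` (§3): `∫ w·SB ≤ [(40(1+η_c)(a₀₀F₀₀ + a₀₂F₀₂ + a₀₄F₀₄ + a₁(F₁+F₂) + a₃(F₃+F₄)) + a_E F_E)·‖φ‖²
  + 40(1+η_c)(p₀₀F₀₀ + p₀₂F₀₂ + p₁(F₁+F₂))·∫orbitDist²φ²]/K₁(1,1)²` for bounded measurable nonnegative `w, n, 𝒴_i, e^{-q}` with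
  `w ≠ 0 ⇒ n ≤ N`.  β-power bookkeeping (memo v8 §2): against the gains `β^{-(a+k+j)}` of `…RecordFibreFactor`, every `‖φ‖²`
  coefficient is `O(β⁻¹·polylog)` except `a_E ∝ η_c²`, and every `∫orbitDist²φ²` coefficient is `O(1)` — the potential.
-/

noncomputable section

open MeasureTheory Filter Topology Real
open scoped BigOperators

namespace Summit.QuantumFields.YangMills.Theorems.FemtoTransferGap.TwoLattice.ConstTube

/-! ## §1 The pointwise split (pure real algebra) -/

set_option maxHeartbeats 1600000 in
-- one `ring` identity between two ~3 kB polynomials in 25 variables.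
/-- ★ **The slow bound times a weight, split into monomials** (`0 ≤ s ≤ n`; all displayed data nonnegative). [folklore] -/
theorem slow_bound_mul_le_split {KN AL CB QG Λ₁ φ2 ψ2 β c₂ m dO ηc cq a₀' Y0 Y1 Y2 Y3 Y4 E s n w : ℝ}
    (hs : 0 ≤ s) (hsn : s ≤ n) (hw : 0 ≤ w) (hY0 : 0 ≤ Y0) (hΛ : 0 ≤ Λ₁) (hCB : 0 ≤ CB) (hβ : 0 ≤ β) (hφ2 : 0 ≤ φ2) (hψ2 : 0 ≤ ψ2) (hη : 0 ≤ ηc) :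
    w * (40 * (1 + ηc) *
            ((Y0) *
                (((((2 * (3 / 2 * (KN) ^ 2 * β * (s) ^ 2 + 27 * c₂ ^ 2 * (s) ^ 4) + 4 * (2 * (KN) ^ 2 * β ^ 2 * (AL) ^ 2 * (s) ^ 2) * m ^ 2) * Λ₁ + 2 * (2 * (KN) ^ 2 * β ^ 2 * (AL) ^ 2 * (s) ^ 2) * (CB)) +
              2 * ((2 * (3 * (QG) ^ 2 * dO ^ 2 + 6 * (KN) ^ 2 * β ^ 2 * (AL) ^ 2 * (s) ^ 2) + 4 * ((2 * (KN) ^ 2 * β ^ 2 * (AL) ^ 2 * (s) ^ 2) + (2 * (QG) ^ 2) * dO ^ 2 + (2 * (QG) ^ 2) * m ^ 2)) * Λ₁ + 2 * (2 * (QG) ^ 2) * (CB)) * m ^ 2) * Λ₁ +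
            ((2 * (3 * (QG) ^ 2 * dO ^ 2 + 6 * (KN) ^ 2 * β ^ 2 * (AL) ^ 2 * (s) ^ 2) + 4 * ((2 * (KN) ^ 2 * β ^ 2 * (AL) ^ 2 * (s) ^ 2) + (2 * (QG) ^ 2) * dO ^ 2 + (2 * (QG) ^ 2) * m ^ 2)) * Λ₁ + 2 * (2 * (QG) ^ 2) * (CB)) *
              (CB)) * φ2 +
          2 * ((2 * (3 * (QG) ^ 2 * dO ^ 2 + 6 * (KN) ^ 2 * β ^ 2 * (AL) ^ 2 * (s) ^ 2) + 4 * ((2 * (KN) ^ 2 * β ^ 2 * (AL) ^ 2 * (s) ^ 2) + (2 * (QG) ^ 2) * dO ^ 2 + (2 * (QG) ^ 2) * m ^ 2)) * Λ₁ + 2 * (2 * (QG) ^ 2) * (CB)) * Λ₁ *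
            ψ2) +
              ((Y1) + (Y2)) *
                (((((2 * (KN) ^ 2 * β / 2 + 4 * (KN) ^ 2 * β ^ 2 * (AL) ^ 2 * m ^ 2) * Λ₁ + 2 * (KN) ^ 2 * β ^ 2 * (AL) ^ 2 * (CB)) +
              2 * ((2 * 2 * (KN) ^ 2 * β ^ 2 * (AL) ^ 2 + 4 * ((KN) ^ 2 * β ^ 2 * (AL) ^ 2 + 0 * dO ^ 2 + 0 * m ^ 2)) * Λ₁ + 2 * 0 * (CB)) * m ^ 2) * Λ₁ +
            ((2 * 2 * (KN) ^ 2 * β ^ 2 * (AL) ^ 2 + 4 * ((KN) ^ 2 * β ^ 2 * (AL) ^ 2 + 0 * dO ^ 2 + 0 * m ^ 2)) * Λ₁ + 2 * 0 * (CB)) *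
              (CB)) * φ2 +
          2 * ((2 * 2 * (KN) ^ 2 * β ^ 2 * (AL) ^ 2 + 4 * ((KN) ^ 2 * β ^ 2 * (AL) ^ 2 + 0 * dO ^ 2 + 0 * m ^ 2)) * Λ₁ + 2 * 0 * (CB)) * Λ₁ *
            ψ2) +
              9 * c₂ ^ 2 * ((Y3) + (Y4)) *
                (2 * Λ₁ * Λ₁ * φ2)) +
          2 * ηc ^ 2 * (cq * (a₀' * E)) * (2 * Λ₁ * Λ₁ * φ2)) ≤
      ((40 * (1 + ηc) * ((2 * ((14 * (QG) ^ 2 * dO ^ 2 + 8 * (QG) ^ 2 * m ^ 2) * Λ₁ + 4 * (QG) ^ 2 * (CB)) * m ^ 2 * Λ₁ + ((14 * (QG) ^ 2 * dO ^ 2 + 8 * (QG) ^ 2 * m ^ 2) * Λ₁ + 4 * (QG) ^ 2 * (CB)) * (CB)) * (w * Y0) + (((3 * (KN) ^ 2 * β + 8 * ((KN) ^ 2 * β ^ 2 * (AL) ^ 2) * m ^ 2) * Λ₁ + 4 * ((KN) ^ 2 * β ^ 2 * (AL) ^ 2) * (CB) + 2 * (20 * ((KN) ^ 2 * β ^ 2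 * (AL) ^ 2) * Λ₁) * m ^ 2) * Λ₁ + (20 * ((KN) ^ 2 * β ^ 2 * (AL) ^ 2) * Λ₁) * (CB)) * (w * n ^ 2 * Y0) + (54 * c₂ ^ 2 * Λ₁ * Λ₁) * (w * n ^ 4 * Y0) + ((((KN) ^ 2 * β + 4 * ((KN) ^ 2 * β ^ 2 * (AL) ^ 2) * m ^ 2) * Λ₁ + 2 * ((KN) ^ 2 * β ^ 2 * (AL) ^ 2) * (CB) + 16 * ((KN) ^ 2 * β ^ 2 * (AL) ^ 2) * Λ₁ * m ^ 2) * Λ₁ + 8 * ((KN) ^ 2 * β ^ 2 * (AL) ^ 2) * Λ₁ * (CB)) * ((w * Y1) + (w * Y2)) + (18 * c₂ ^ 2 * Λ₁ * Λ₁) * ((w * Y3) + (w * Y4))) + (4 * ηc ^ 2 * cq * a₀' * Λ₁ * Λ₁) * (w * E)) * φ2 +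
          40 * (1 + ηc) * ((2 * ((14 * (QG) ^ 2 * dO ^ 2 + 8 * (QG) ^ 2 * m ^ 2) * Λ₁ + 4 * (QG) ^ 2 * (CB)) * Λ₁) * (w * Y0) + (2 * (20 * ((KN) ^ 2 * β ^ 2 * (AL) ^ 2) * Λ₁) * Λ₁) * (w * n ^ 2 * Y0) + (16 * ((KN) ^ 2 * β ^ 2 * (AL) ^ 2) * Λ₁ * Λ₁) * ((w * Y1) + (w * Y2))) * ψ2) := by
  have h2 : s ^ 2 ≤ n ^ 2 := pow_le_pow_left₀ hs hsn 2
  have h4 : s ^ 4 ≤ n ^ 4 := pow_le_pow_left₀ hs hsn 4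
  have hA02 : 0 ≤ (((3 * (KN) ^ 2 * β + 8 * ((KN) ^ 2 * β ^ 2 * (AL) ^ 2) * m ^ 2) * Λ₁ + 4 * ((KN) ^ 2 * β ^ 2 * (AL) ^ 2) * (CB) + 2 * (20 * ((KN) ^ 2 * β ^ 2 * (AL) ^ 2) * Λ₁) * m ^ 2) * Λ₁ + (20 * ((KN) ^ 2 * β ^ 2 * (AL) ^ 2) * Λ₁) * (CB)) := by positivity
  have hA04 : 0 ≤ (54 * c₂ ^ 2 * Λ₁ * Λ₁) := by positivity
  have hP02 : 0 ≤ (2 * (20 * ((KN) ^ 2 * β ^ 2 * (AL) ^ 2) * Λ₁) * Λ₁) := by positivity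
  have hX2 : 0 ≤ w * (n ^ 2 - s ^ 2) * Y0 := mul_nonneg (mul_nonneg hw (sub_nonneg.2 h2)) hY0
  have hX4 : 0 ≤ w * (n ^ 4 - s ^ 4) * Y0 := mul_nonneg (mul_nonneg hw (sub_nonneg.2 h4)) hY0
  have h40 : (0 : ℝ) ≤ 40 * (1 + ηc) := by positivity
  have key : ((40 * (1 + ηc) * ((2 * ((14 * (QG) ^ 2 * dO ^ 2 + 8 * (QG) ^ 2 * m ^ 2) * Λ₁ + 4 * (QG) ^ 2 * (CB)) * m ^ 2 * Λ₁ + ((14 * (QG) ^ 2 * dO ^ 2 + 8 * (QG) ^ 2 * m ^ 2) * Λ₁ + 4 * (QG) ^ 2 * (CB)) * (CB)) * (w * Y0) + (((3 * (KN) ^ 2 * β + 8 * ((KN) ^ 2 * β ^ 2 * (AL) ^ 2) * m ^ 2) * Λ₁ + 4 * ((KN) ^ 2 * β ^ 2 * (AL) ^ 2) * (CB) + 2 * (20 * ((KN) ^ 2 * β ^ 2 * (AL) ^ 2) * Λ₁) * m ^ 2) * Λ₁ + (20 * ((KN) ^ 2 * β ^ 2 * (AL) ^ 2) * Λ₁)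 * (CB)) * (w * n ^ 2 * Y0) + (54 * c₂ ^ 2 * Λ₁ * Λ₁) * (w * n ^ 4 * Y0) + ((((KN) ^ 2 * β + 4 * ((KN) ^ 2 * β ^ 2 * (AL) ^ 2) * m ^ 2) * Λ₁ + 2 * ((KN) ^ 2 * β ^ 2 * (AL) ^ 2) * (CB) + 16 * ((KN) ^ 2 * β ^ 2 * (AL) ^ 2) * Λ₁ * m ^ 2) * Λ₁ + 8 * ((KN) ^ 2 * β ^ 2 * (AL) ^ 2) * Λ₁ * (CB)) * ((w * Y1) + (w * Y2)) + (18 * c₂ ^ 2 * Λ₁ * Λ₁) * ((w * Y3) + (w * Y4))) + (4 * ηc ^ 2 * cq * a₀' * Λ₁ * Λ₁) * (w * E)) * φ2 +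
          40 * (1 + ηc) * ((2 * ((14 * (QG) ^ 2 * dO ^ 2 + 8 * (QG) ^ 2 * m ^ 2) * Λ₁ + 4 * (QG) ^ 2 * (CB)) * Λ₁) * (w * Y0) + (2 * (20 * ((KN) ^ 2 * β ^ 2 * (AL) ^ 2) * Λ₁) * Λ₁) * (w * n ^ 2 * Y0) + (16 * ((KN) ^ 2 * β ^ 2 * (AL) ^ 2) * Λ₁ * Λ₁) * ((w * Y1) + (w * Y2))) * ψ2) -
      w * (40 * (1 + ηc) *
            ((Y0) *
                (((((2 * (3 / 2 * (KN) ^ 2 * β * (s) ^ 2 + 27 * c₂ ^ 2 * (s) ^ 4) + 4 * (2 * (KN) ^ 2 * β ^ 2 * (AL) ^ 2 * (s) ^ 2) * m ^ 2) * Λ₁ + 2 * (2 * (KN) ^ 2 * β ^ 2 * (AL) ^ 2 * (s) ^ 2) * (CB)) +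
              2 * ((2 * (3 * (QG) ^ 2 * dO ^ 2 + 6 * (KN) ^ 2 * β ^ 2 * (AL) ^ 2 * (s) ^ 2) + 4 * ((2 * (KN) ^ 2 * β ^ 2 * (AL) ^ 2 * (s) ^ 2) + (2 * (QG) ^ 2) * dO ^ 2 + (2 * (QG) ^ 2) * m ^ 2)) * Λ₁ + 2 * (2 * (QG) ^ 2) * (CB)) * m ^ 2) * Λ₁ +
            ((2 * (3 * (QG) ^ 2 * dO ^ 2 + 6 * (KN) ^ 2 * β ^ 2 * (AL) ^ 2 * (s) ^ 2) + 4 * ((2 * (KN) ^ 2 * β ^ 2 * (AL) ^ 2 * (s) ^ 2) + (2 * (QG) ^ 2) * dO ^ 2 + (2 * (QG) ^ 2) * m ^ 2)) * Λ₁ + 2 * (2 * (QG) ^ 2) * (CB)) *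
              (CB)) * φ2 +
          2 * ((2 * (3 * (QG) ^ 2 * dO ^ 2 + 6 * (KN) ^ 2 * β ^ 2 * (AL) ^ 2 * (s) ^ 2) + 4 * ((2 * (KN) ^ 2 * β ^ 2 * (AL) ^ 2 * (s) ^ 2) + (2 * (QG) ^ 2) * dO ^ 2 + (2 * (QG) ^ 2) * m ^ 2)) * Λ₁ + 2 * (2 * (QG) ^ 2) * (CB)) * Λ₁ *
            ψ2) +
              ((Y1) + (Y2)) *
                (((((2 * (KN) ^ 2 * β / 2 + 4 * (KN) ^ 2 * β ^ 2 * (AL) ^ 2 * m ^ 2) * Λ₁ + 2 * (KN) ^ 2 * β ^ 2 * (AL) ^ 2 * (CB)) +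
              2 * ((2 * 2 * (KN) ^ 2 * β ^ 2 * (AL) ^ 2 + 4 * ((KN) ^ 2 * β ^ 2 * (AL) ^ 2 + 0 * dO ^ 2 + 0 * m ^ 2)) * Λ₁ + 2 * 0 * (CB)) * m ^ 2) * Λ₁ +
            ((2 * 2 * (KN) ^ 2 * β ^ 2 * (AL) ^ 2 + 4 * ((KN) ^ 2 * β ^ 2 * (AL) ^ 2 + 0 * dO ^ 2 + 0 * m ^ 2)) * Λ₁ + 2 * 0 * (CB)) *
              (CB)) * φ2 +
          2 * ((2 * 2 * (KN) ^ 2 * β ^ 2 * (AL) ^ 2 + 4 * ((KN) ^ 2 * β ^ 2 * (AL) ^ 2 + 0 * dO ^ 2 + 0 * m ^ 2)) * Λ₁ + 2 * 0 * (CB)) * Λ₁ *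
            ψ2) +
              9 * c₂ ^ 2 * ((Y3) + (Y4)) *
                (2 * Λ₁ * Λ₁ * φ2)) +
          2 * ηc ^ 2 * (cq * (a₀' * E)) * (2 * Λ₁ * Λ₁ * φ2)) =
      40 * (1 + ηc) * (((((3 * (KN) ^ 2 * β + 8 * ((KN) ^ 2 * β ^ 2 * (AL) ^ 2) * m ^ 2) * Λ₁ + 4 * ((KN) ^ 2 * β ^ 2 * (AL) ^ 2) * (CB) + 2 * (20 * ((KN) ^ 2 * β ^ 2 * (AL) ^ 2) * Λ₁) * m ^ 2) * Λ₁ + (20 * ((KN) ^ 2 * β ^ 2 * (AL) ^ 2) * Λ₁) * (CB)) * φ2 + (2 * (20 * ((KN) ^ 2 * β ^ 2 * (AL) ^ 2) * Λ₁) * Λ₁) * ψ2) * (w * (n ^ 2 - s ^ 2) * Y0) +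
        (54 * c₂ ^ 2 * Λ₁ * Λ₁) * φ2 * (w * (n ^ 4 - s ^ 4) * Y0)) := by ring
  have hpos : 0 ≤ 40 * (1 + ηc) * (((((3 * (KN) ^ 2 * β + 8 * ((KN) ^ 2 * β ^ 2 * (AL) ^ 2) * m ^ 2) * Λ₁ + 4 * ((KN) ^ 2 * β ^ 2 * (AL) ^ 2) * (CB) + 2 * (20 * ((KN) ^ 2 * β ^ 2 * (AL) ^ 2) * Λ₁) * m ^ 2) * Λ₁ + (20 * ((KN) ^ 2 * β ^ 2 * (AL) ^ 2) * Λ₁) * (CB)) * φ2 + (2 * (20 * ((KN) ^ 2 * β ^ 2 * (AL) ^ 2) * Λ₁) * Λ₁) * ψ2) * (w * (n ^ 2 - s ^ 2) * Y0) +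
        (54 * c₂ ^ 2 * Λ₁ * Λ₁) * φ2 * (w * (n ^ 4 - s ^ 4) * Y0)) :=
    mul_nonneg h40 (add_nonneg (mul_nonneg (add_nonneg (mul_nonneg hA02 hφ2) (mul_nonneg hP02 hψ2)) hX2) (mul_nonneg (mul_nonneg hA04 hφ2) hX4))
  linarith

/-! ## §2 Linearity of the integral for the eight-term combination -/

/-- `∫` of the eight-term combination `((A(c₀f₀ + c₁f₁ + c₂f₂ + c₃(f₃+f₄) + c₅(f₅+f₆)) + c₇f₇)P + A(d₀f₀ + d₁f₁ + d₃(f₃+f₄))Q)/K`. [folklore] -/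
theorem integral_lin8_div {α : Type*} [MeasurableSpace α] {μ : Measure α} {f₀ f₁ f₂ f₃ f₄ f₅ f₆ f₇ : α → ℝ}
    (h₀ : Integrable f₀ μ) (h₁ : Integrable f₁ μ) (h₂ : Integrable f₂ μ) (h₃ : Integrable f₃ μ) (h₄ : Integrable f₄ μ)
    (h₅ : Integrable f₅ μ) (h₆ : Integrable f₆ μ) (h₇ : Integrable f₇ μ) (A c₀ c₁ c₂ c₃ c₅ c₇ d₀ d₁ d₃ P Q K : ℝ) :
    ∫ x, ((A * (c₀ * f₀ x + c₁ * f₁ x + c₂ * f₂ x + c₃ * (f₃ x + f₄ x) + c₅ * (f₅ x + f₆ x)) + c₇ * f₇ x) * P +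
          A * (d₀ * f₀ x + d₁ * f₁ x + d₃ * (f₃ x + f₄ x)) * Q) / K ∂μ =
      ((A * (c₀ * (∫ x, f₀ x ∂μ) + c₁ * (∫ x, f₁ x ∂μ) + c₂ * (∫ x, f₂ x ∂μ) + c₃ * ((∫ x, f₃ x ∂μ) + (∫ x, f₄ x ∂μ)) + c₅ * ((∫ x, f₅ x ∂μ) + (∫ x, f₆ x ∂μ))) +
          c₇ * (∫ x, f₇ x ∂μ)) * P + A * (d₀ * (∫ x, f₀ x ∂μ) + d₁ * (∫ x, f₁ x ∂μ) + d₃ * ((∫ x, f₃ x ∂μ) + (∫ x, f₄ x ∂μ))) * Q) / K := by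
  have e : ∀ x, ((A * (c₀ * f₀ x + c₁ * f₁ x + c₂ * f₂ x + c₃ * (f₃ x + f₄ x) + c₅ * (f₅ x + f₆ x)) + c₇ * f₇ x) * P +
          A * (d₀ * f₀ x + d₁ * f₁ x + d₃ * (f₃ x + f₄ x)) * Q) / K =
      ((A * c₀ * P + A * d₀ * Q) / K) * f₀ x + ((A * c₁ * P + A * d₁ * Q) / K) * f₁ x + ((A * c₂ * P) / K) * f₂ x +
        ((A * c₃ * P + A * d₃ * Q) / K) * f₃ x + ((A * c₃ * P + A * d₃ * Q) / K) * f₄ x + ((A * c₅ * P) / K) * f₅ x +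
        ((A * c₅ * P) / K) * f₆ x + ((c₇ * P) / K) * f₇ x := fun x => by ring
  simp_rw [e]
  have g₀ := h₀.const_mul ((A * c₀ * P + A * d₀ * Q) / K)
  have g₁ := h₁.const_mul ((A * c₁ * P + A * d₁ * Q) / K)
  have g₂ := h₂.const_mul ((A * c₂ * P) / K)
  have g₃ := h₃.const_mul ((A * c₃ * P + A * d₃ * Q) / K)
  have g₄ := h₄.const_mul ((A * c₃ * P + A * d₃ * Q) / K)
  have g₅ := h₅.const_mul ((A * c₅ * P) / K)
  have g₆ := h₆.const_mul ((A * c₅ * P) / K)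
  have g₇ := h₇.const_mul ((c₇ * P) / K)
  have s1 : Integrable (fun x => (A * c₀ * P + A * d₀ * Q) / K * f₀ x + (A * c₁ * P + A * d₁ * Q) / K * f₁ x) μ := g₀.add g₁
  have s2 : Integrable (fun x => (A * c₀ * P + A * d₀ * Q) / K * f₀ x + (A * c₁ * P + A * d₁ * Q) / K * f₁ x + A * c₂ * P / K * f₂ x) μ := s1.add g₂
  have s3 : Integrable (fun x => (A * c₀ * P + A * d₀ * Q) / K * f₀ x + (A * c₁ * P + A * d₁ * Q) / K * f₁ x + A * c₂ * P / K * f₂ x + (A * c₃ * P + A * d₃ * Q) / K * f₃ x) μ := s2.add g₃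
  have s4 : Integrable (fun x => (A * c₀ * P + A * d₀ * Q) / K * f₀ x + (A * c₁ * P + A * d₁ * Q) / K * f₁ x + A * c₂ * P / K * f₂ x + (A * c₃ * P + A * d₃ * Q) / K * f₃ x + (A * c₃ * P + A * d₃ * Q) / K * f₄ x) μ := s3.add g₄
  have s5 : Integrable (fun x => (A * c₀ * P + A * d₀ * Q) / K * f₀ x + (A * c₁ * P + A * d₁ * Q) / K * f₁ x + A * c₂ * P / K * f₂ x + (A * c₃ * P + A * d₃ * Q) / K * f₃ x + (A * c₃ * P + A * d₃ * Q) / K * f₄ x + A * c₅ * P / K * f₅ x) μ := s4.add g₅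
  have s6 : Integrable (fun x => (A * c₀ * P + A * d₀ * Q) / K * f₀ x + (A * c₁ * P + A * d₁ * Q) / K * f₁ x + A * c₂ * P / K * f₂ x + (A * c₃ * P + A * d₃ * Q) / K * f₃ x + (A * c₃ * P + A * d₃ * Q) / K * f₄ x + A * c₅ * P / K * f₅ x + A * c₅ * P / K * f₆ x) μ := s5.add g₆
  rw [integral_add s6 g₇, integral_add s5 g₆, integral_add s4 g₅, integral_add s3 g₄, integral_add s2 g₃, integral_add s1 g₂, integral_add g₀ g₁]
  simp only [integral_const_mul]
  ring

/-! ## §3 ★★ The integrated slow bound, split -/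

/-- Integrability of `w·nᵃ·Y` for bounded measurable nonnegative data on a finite measure, `w ≠ 0 ⇒ n ≤ N`. [folklore] -/
theorem integrable_weight_mul_pow_mul {α : Type*} [MeasurableSpace α] {μ : Measure α} [IsFiniteMeasure μ]
    {w n Y : α → ℝ} (hwm : Measurable w) (hnm : Measurable n) (hYm : Measurable Y) {Cw N B : ℝ}
    (hw : ∀ x, 0 ≤ w x ∧ w x ≤ Cw) (hn : ∀ x, 0 ≤ n x) (hwn : ∀ x, w x ≠ 0 → n x ≤ N) (hY : ∀ x, 0 ≤ Y x ∧ Y x ≤ B) (a : ℕ) :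
    Integrable (fun x => w x * n x ^ a * Y x) μ := by
  refine (integrable_const (Cw * |N| ^ a * B)).mono' ((hwm.mul (hnm.pow_const a)).mul hYm).aestronglyMeasurable (ae_of_all _ fun x => ?_)
  rw [Real.norm_eq_abs, abs_of_nonneg (mul_nonneg (mul_nonneg (hw x).1 (pow_nonneg (hn x) a)) (hY x).1)]
  by_cases hx : w x = 0
  · rw [hx, zero_mul, zero_mul]
    have hCw : 0 ≤ Cw := (hw x).1.trans (hw x).2
    have hB : 0 ≤ B := (hY x).1.trans (hY x).2
    positivity
  · have h1 : n x ^ a ≤ |N| ^ a := pow_le_pow_left₀ (hn x) ((hwn x hx).trans (le_abs_self N)) a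
    exact mul_le_mul (mul_le_mul (hw x).2 h1 (pow_nonneg (hn x) a) ((hw x).1.trans (hw x).2)) (hY x).2 (hY x).1
      (mul_nonneg ((hw x).1.trans (hw x).2) (pow_nonneg (abs_nonneg N) a))

set_option maxRecDepth 4096 in
set_option maxHeartbeats 4000000 in
-- kilobyte-sized integrands (the slow bound of record with the fibre atoms abstracted); the pointwise step is `slow_bound_mul_le_split`.
/-- ★★ **THE INTEGRATED SLOW BOUND, SPLIT INTO EIGHT FIBRE FACTORS** (see the module docstring).  The measure space, the weight `w`, the
size `n` (`s = min n R_in²`), the five colour-averaged central transfers `𝒴₀,…,𝒴₄` and the fibre amplitude `E = e^{-q}` are abstract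
bounded measurable nonnegative functions; of record `μ = orthoTransverse L`, `w` = the capped inner weight at `x_v`, `n = ‖x_v‖²`. [folklore] -/
theorem integral_weight_mul_slow_bound_le_split {α : Type*} [MeasurableSpace α] {μ : Measure α} [IsFiniteMeasure μ]
    {w n Y0 Y1 Y2 Y3 Y4 E : α → ℝ} (hwm : Measurable w) (hnm : Measurable n) (hY0m : Measurable Y0) (hY1m : Measurable Y1)
    (hY2m : Measurable Y2) (hY3m : Measurable Y3) (hY4m : Measurable Y4) (hEm : Measurable E)
    {Cw N B0 B1 B2 B3 B4 BE : ℝ} (hw : ∀ x, 0 ≤ w x ∧ w x ≤ Cw) (hn : ∀ x, 0 ≤ n x) (hwn : ∀ x, w x ≠ 0 → n x ≤ N)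
    (hY0 : ∀ x, 0 ≤ Y0 x ∧ Y0 x ≤ B0) (hY1 : ∀ x, 0 ≤ Y1 x ∧ Y1 x ≤ B1) (hY2 : ∀ x, 0 ≤ Y2 x ∧ Y2 x ≤ B2) (hY3 : ∀ x, 0 ≤ Y3 x ∧ Y3 x ≤ B3)
    (hY4 : ∀ x, 0 ≤ Y4 x ∧ Y4 x ≤ B4) (hE : ∀ x, 0 ≤ E x ∧ E x ≤ BE)
    {KN AL CB QG Λ₁ K1 φ2 ψ2 β c₂ m dO Rin ηc cq a₀' : ℝ} (hΛ : 0 ≤ Λ₁) (hCB : 0 ≤ CB) (hβ : 0 ≤ β) (hφ2 : 0 ≤ φ2) (hψ2 : 0 ≤ ψ2)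
    (hη : 0 ≤ ηc) (hcq : 0 ≤ cq) (ha₀' : 0 ≤ a₀') :
    ∫ x, (w x * ((40 * (1 + ηc) *
            ((Y0 x) *
                (((((2 * (3 / 2 * (KN) ^ 2 * β * (min (n x) (Rin ^ 2)) ^ 2 + 27 * c₂ ^ 2 * (min (n x) (Rin ^ 2)) ^ 4) + 4 * (2 * (KN) ^ 2 * β ^ 2 * (AL) ^ 2 * (min (n x) (Rin ^ 2)) ^ 2) * m ^ 2) * Λ₁ + 2 * (2 * (KN) ^ 2 * β ^ 2 * (AL) ^ 2 * (min (n x) (Rin ^ 2)) ^ 2) * (CB)) +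
              2 * ((2 * (3 * (QG) ^ 2 * dO ^ 2 + 6 * (KN) ^ 2 * β ^ 2 * (AL) ^ 2 * (min (n x) (Rin ^ 2)) ^ 2) + 4 * ((2 * (KN) ^ 2 * β ^ 2 * (AL) ^ 2 * (min (n x) (Rin ^ 2)) ^ 2) + (2 * (QG) ^ 2) * dO ^ 2 + (2 * (QG) ^ 2) * m ^ 2)) * Λ₁ + 2 * (2 * (QG) ^ 2) * (CB)) * m ^ 2) * Λ₁ +
            ((2 * (3 * (QG) ^ 2 * dO ^ 2 + 6 * (KN) ^ 2 * β ^ 2 * (AL) ^ 2 * (min (n x) (Rin ^ 2)) ^ 2) + 4 * ((2 * (KN) ^ 2 * β ^ 2 * (AL) ^ 2 * (min (n x) (Rin ^ 2)) ^ 2) + (2 * (QG) ^ 2) * dO ^ 2 + (2 * (QG) ^ 2) * m ^ 2)) * Λ₁ + 2 * (2 * (QG) ^ 2) * (CB)) *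
              (CB)) * φ2 +
          2 * ((2 * (3 * (QG) ^ 2 * dO ^ 2 + 6 * (KN) ^ 2 * β ^ 2 * (AL) ^ 2 * (min (n x) (Rin ^ 2)) ^ 2) + 4 * ((2 * (KN) ^ 2 * β ^ 2 * (AL) ^ 2 * (min (n x) (Rin ^ 2)) ^ 2) + (2 * (QG) ^ 2) * dO ^ 2 + (2 * (QG) ^ 2) * m ^ 2)) * Λ₁ + 2 * (2 * (QG) ^ 2) * (CB)) * Λ₁ *
            ψ2) +
              ((Y1 x) + (Y2 x)) *
                (((((2 * (KN) ^ 2 * β / 2 + 4 * (KN) ^ 2 * β ^ 2 * (AL) ^ 2 * m ^ 2) * Λ₁ + 2 * (KN) ^ 2 * β ^ 2 * (AL) ^ 2 * (CB)) +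
              2 * ((2 * 2 * (KN) ^ 2 * β ^ 2 * (AL) ^ 2 + 4 * ((KN) ^ 2 * β ^ 2 * (AL) ^ 2 + 0 * dO ^ 2 + 0 * m ^ 2)) * Λ₁ + 2 * 0 * (CB)) * m ^ 2) * Λ₁ +
            ((2 * 2 * (KN) ^ 2 * β ^ 2 * (AL) ^ 2 + 4 * ((KN) ^ 2 * β ^ 2 * (AL) ^ 2 + 0 * dO ^ 2 + 0 * m ^ 2)) * Λ₁ + 2 * 0 * (CB)) *
              (CB)) * φ2 +
          2 * ((2 * 2 * (KN) ^ 2 * β ^ 2 * (AL) ^ 2 + 4 * ((KN) ^ 2 * β ^ 2 * (AL) ^ 2 + 0 * dO ^ 2 + 0 * m ^ 2)) * Λ₁ + 2 * 0 * (CB)) * Λ₁ *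
            ψ2) +
              9 * c₂ ^ 2 * ((Y3 x) + (Y4 x)) *
                (2 * Λ₁ * Λ₁ * φ2)) +
          2 * ηc ^ 2 * (cq * (a₀' * E x)) * (2 * Λ₁ * Λ₁ * φ2)) /
        K1 ^ 2) : ℝ) ∂μ ≤
      (((40 * (1 + ηc) * ((2 * ((14 * (QG) ^ 2 * dO ^ 2 + 8 * (QG) ^ 2 * m ^ 2) * Λ₁ + 4 * (QG) ^ 2 * (CB)) * m ^ 2 * Λ₁ + ((14 * (QG) ^ 2 * dO ^ 2 + 8 * (QG) ^ 2 * m ^ 2) * Λ₁ + 4 * (QG) ^ 2 * (CB)) * (CB)) * (∫ x, w x * Y0 x ∂μ) + (((3 * (KN) ^ 2 * β + 8 * ((KN) ^ 2 * β ^ 2 * (AL) ^ 2) * m ^ 2) * Λ₁ + 4 * ((KN) ^ 2 * β ^ 2 * (AL) ^ 2) * (CB) + 2 * (20 * ((KN) ^ 2 * β ^ 2 * (AL) ^ 2) * Λ₁) * m ^ 2) * Λ₁ + (20 * ((KN) ^ 2 * β ^ 2 * (AL) ^ 2) * Λ₁) * (CB)) * (∫ x, w x * n x ^ 2 * Y0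 x ∂μ) + (54 * c₂ ^ 2 * Λ₁ * Λ₁) * (∫ x, w x * n x ^ 4 * Y0 x ∂μ) + ((((KN) ^ 2 * β + 4 * ((KN) ^ 2 * β ^ 2 * (AL) ^ 2) * m ^ 2) * Λ₁ + 2 * ((KN) ^ 2 * β ^ 2 * (AL) ^ 2) * (CB) + 16 * ((KN) ^ 2 * β ^ 2 * (AL) ^ 2) * Λ₁ * m ^ 2) * Λ₁ + 8 * ((KN) ^ 2 * β ^ 2 * (AL) ^ 2) * Λ₁ * (CB)) * ((∫ x, w x * Y1 x ∂μ) + (∫ x, w x * Y2 x ∂μ)) + (18 * c₂ ^ 2 * Λ₁ * Λ₁) * ((∫ x, w x * Y3 x ∂μ) + (∫ x, w x * Y4 x ∂μ))) + (4 * ηc ^ 2 * cq * a₀' * Λ₁ * Λ₁) * (∫ x, w x * E x ∂μ)) * φ2 +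
          40 * (1 + ηc) * ((2 * ((14 * (QG) ^ 2 * dO ^ 2 + 8 * (QG) ^ 2 * m ^ 2) * Λ₁ + 4 * (QG) ^ 2 * (CB)) * Λ₁) * (∫ x, w x * Y0 x ∂μ) + (2 * (20 * ((KN) ^ 2 * β ^ 2 * (AL) ^ 2) * Λ₁) * Λ₁) * (∫ x, w x * n x ^ 2 * Y0 x ∂μ) + (16 * ((KN) ^ 2 * β ^ 2 * (AL) ^ 2) * Λ₁ * Λ₁) * ((∫ x, w x * Y1 x ∂μ) + (∫ x, w x * Y2 x ∂μ))) * ψ2)) /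
        K1 ^ 2 := by
  -- the eight integrable monomials
  have hone : ∀ x, 0 ≤ (fun _ : α => (1 : ℝ)) x ∧ (fun _ : α => (1 : ℝ)) x ≤ 1 := fun _ => ⟨zero_le_one, le_rfl⟩
  have hn1 : ∀ x, w x ≠ 0 → (fun _ : α => (1 : ℝ)) x ≤ 1 := fun _ _ => le_rfl
  have i00 : Integrable (fun x => w x * Y0 x) μ := by
    have h := integrable_weight_mul_pow_mul (μ := μ) hwm measurable_const hY0m hw (fun x => (hone x).1) hn1 hY0 0
    simpa only [pow_zero, mul_one] using h
  have i02 : Integrable (fun x => w x * n x ^ 2 * Y0 x) μ := integrable_weight_mul_pow_mul (μ := μ) hwm hnm hY0m hw hn hwn hY0 2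
  have i04 : Integrable (fun x => w x * n x ^ 4 * Y0 x) μ := integrable_weight_mul_pow_mul (μ := μ) hwm hnm hY0m hw hn hwn hY0 4
  have i1 : Integrable (fun x => w x * Y1 x) μ := by
    have h := integrable_weight_mul_pow_mul (μ := μ) hwm measurable_const hY1m hw (fun x => (hone x).1) hn1 hY1 0
    simpa only [pow_zero, mul_one] using h
  have i2 : Integrable (fun x => w x * Y2 x) μ := by
    have h := integrable_weight_mul_pow_mul (μ := μ) hwm measurable_const hY2m hw (fun x => (hone x).1) hn1 hY2 0
    simpa only [pow_zero, mul_one] using h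
  have i3 : Integrable (fun x => w x * Y3 x) μ := by
    have h := integrable_weight_mul_pow_mul (μ := μ) hwm measurable_const hY3m hw (fun x => (hone x).1) hn1 hY3 0
    simpa only [pow_zero, mul_one] using h
  have i4 : Integrable (fun x => w x * Y4 x) μ := by
    have h := integrable_weight_mul_pow_mul (μ := μ) hwm measurable_const hY4m hw (fun x => (hone x).1) hn1 hY4 0
    simpa only [pow_zero, mul_one] using h
  have iE : Integrable (fun x => w x * E x) μ := by
    have h := integrable_weight_mul_pow_mul (μ := μ) hwm measurable_const hEm hw (fun x => (hone x).1) hn1 hE 0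
    simpa only [pow_zero, mul_one] using h
  -- the pointwise split
  have hpt : ∀ x, w x * ((40 * (1 + ηc) *
            ((Y0 x) *
                (((((2 * (3 / 2 * (KN) ^ 2 * β * (min (n x) (Rin ^ 2)) ^ 2 + 27 * c₂ ^ 2 * (min (n x) (Rin ^ 2)) ^ 4) + 4 * (2 * (KN) ^ 2 * β ^ 2 * (AL) ^ 2 * (min (n x) (Rin ^ 2)) ^ 2) * m ^ 2) * Λ₁ + 2 * (2 * (KN) ^ 2 * β ^ 2 * (AL) ^ 2 * (min (n x) (Rin ^ 2)) ^ 2) * (CB)) +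
              2 * ((2 * (3 * (QG) ^ 2 * dO ^ 2 + 6 * (KN) ^ 2 * β ^ 2 * (AL) ^ 2 * (min (n x) (Rin ^ 2)) ^ 2) + 4 * ((2 * (KN) ^ 2 * β ^ 2 * (AL) ^ 2 * (min (n x) (Rin ^ 2)) ^ 2) + (2 * (QG) ^ 2) * dO ^ 2 + (2 * (QG) ^ 2) * m ^ 2)) * Λ₁ + 2 * (2 * (QG) ^ 2) * (CB)) * m ^ 2) * Λ₁ +
            ((2 * (3 * (QG) ^ 2 * dO ^ 2 + 6 * (KN) ^ 2 * β ^ 2 * (AL) ^ 2 * (min (n x) (Rin ^ 2)) ^ 2) + 4 * ((2 * (KN) ^ 2 * β ^ 2 * (AL) ^ 2 * (min (n x) (Rin ^ 2)) ^ 2) + (2 * (QG) ^ 2) * dO ^ 2 + (2 * (QG) ^ 2) * m ^ 2)) * Λ₁ + 2 * (2 * (QG) ^ 2) * (CB)) *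
              (CB)) * φ2 +
          2 * ((2 * (3 * (QG) ^ 2 * dO ^ 2 + 6 * (KN) ^ 2 * β ^ 2 * (AL) ^ 2 * (min (n x) (Rin ^ 2)) ^ 2) + 4 * ((2 * (KN) ^ 2 * β ^ 2 * (AL) ^ 2 * (min (n x) (Rin ^ 2)) ^ 2) + (2 * (QG) ^ 2) * dO ^ 2 + (2 * (QG) ^ 2) * m ^ 2)) * Λ₁ + 2 * (2 * (QG) ^ 2) * (CB)) * Λ₁ *
            ψ2) +
              ((Y1 x) + (Y2 x)) *
                (((((2 * (KN) ^ 2 * β / 2 + 4 * (KN) ^ 2 * β ^ 2 * (AL) ^ 2 * m ^ 2) * Λ₁ + 2 * (KN) ^ 2 * β ^ 2 * (AL) ^ 2 * (CB)) +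
              2 * ((2 * 2 * (KN) ^ 2 * β ^ 2 * (AL) ^ 2 + 4 * ((KN) ^ 2 * β ^ 2 * (AL) ^ 2 + 0 * dO ^ 2 + 0 * m ^ 2)) * Λ₁ + 2 * 0 * (CB)) * m ^ 2) * Λ₁ +
            ((2 * 2 * (KN) ^ 2 * β ^ 2 * (AL) ^ 2 + 4 * ((KN) ^ 2 * β ^ 2 * (AL) ^ 2 + 0 * dO ^ 2 + 0 * m ^ 2)) * Λ₁ + 2 * 0 * (CB)) *
              (CB)) * φ2 +
          2 * ((2 * 2 * (KN) ^ 2 * β ^ 2 * (AL) ^ 2 + 4 * ((KN) ^ 2 * β ^ 2 * (AL) ^ 2 + 0 * dO ^ 2 + 0 * m ^ 2)) * Λ₁ + 2 * 0 * (CB)) * Λ₁ *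
            ψ2) +
              9 * c₂ ^ 2 * ((Y3 x) + (Y4 x)) *
                (2 * Λ₁ * Λ₁ * φ2)) +
          2 * ηc ^ 2 * (cq * (a₀' * E x)) * (2 * Λ₁ * Λ₁ * φ2)) / K1 ^ 2) ≤
      (((40 * (1 + ηc) * ((2 * ((14 * (QG) ^ 2 * dO ^ 2 + 8 * (QG) ^ 2 * m ^ 2) * Λ₁ + 4 * (QG) ^ 2 * (CB)) * m ^ 2 * Λ₁ + ((14 * (QG) ^ 2 * dO ^ 2 + 8 * (QG) ^ 2 * m ^ 2) * Λ₁ + 4 * (QG) ^ 2 * (CB)) * (CB)) * (w x * Y0 x) + (((3 * (KN) ^ 2 * β + 8 * ((KN) ^ 2 * β ^ 2 * (AL) ^ 2) * m ^ 2) * Λ₁ + 4 * ((KN) ^ 2 * β ^ 2 * (AL) ^ 2) * (CB) + 2 * (20 * ((KN) ^ 2 * β ^ 2 * (AL) ^ 2) * Λ₁) * m ^ 2) * Λ₁ + (20 * ((KN) ^ 2 * β ^ 2 * (AL) ^ 2) * Λ₁) * (CB)) * (w x * n x ^ 2 * Y0 x) + (54 * c₂ ^ 2 * Λ₁ * Λ₁)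 * (w x * n x ^ 4 * Y0 x) + ((((KN) ^ 2 * β + 4 * ((KN) ^ 2 * β ^ 2 * (AL) ^ 2) * m ^ 2) * Λ₁ + 2 * ((KN) ^ 2 * β ^ 2 * (AL) ^ 2) * (CB) + 16 * ((KN) ^ 2 * β ^ 2 * (AL) ^ 2) * Λ₁ * m ^ 2) * Λ₁ + 8 * ((KN) ^ 2 * β ^ 2 * (AL) ^ 2) * Λ₁ * (CB)) * ((w x * Y1 x) + (w x * Y2 x)) + (18 * c₂ ^ 2 * Λ₁ * Λ₁) * ((w x * Y3 x) + (w x * Y4 x))) + (4 * ηc ^ 2 * cq * a₀' * Λ₁ * Λ₁) * (w x * E x)) * φ2 +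
          40 * (1 + ηc) * ((2 * ((14 * (QG) ^ 2 * dO ^ 2 + 8 * (QG) ^ 2 * m ^ 2) * Λ₁ + 4 * (QG) ^ 2 * (CB)) * Λ₁) * (w x * Y0 x) + (2 * (20 * ((KN) ^ 2 * β ^ 2 * (AL) ^ 2) * Λ₁) * Λ₁) * (w x * n x ^ 2 * Y0 x) + (16 * ((KN) ^ 2 * β ^ 2 * (AL) ^ 2) * Λ₁ * Λ₁) * ((w x * Y1 x) + (w x * Y2 x))) * ψ2)) / K1 ^ 2 := fun x => by
    have hs : 0 ≤ min (n x) (Rin ^ 2) := le_min (hn x) (sq_nonneg _)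
    have h := slow_bound_mul_le_split (KN := KN) (AL := AL) (QG := QG) (c₂ := c₂) (m := m) (dO := dO) (cq := cq) (a₀' := a₀')
      (Y1 := Y1 x) (Y2 := Y2 x) (Y3 := Y3 x) (Y4 := Y4 x) (E := E x) hs (min_le_left _ _) (hw x).1 (hY0 x).1 hΛ hCB hβ hφ2 hψ2 hη
    rw [mul_div_assoc']
    exact div_le_div_of_nonneg_right h (sq_nonneg _)
  -- integrate
  have hlin := integral_lin8_div i00 i02 i04 i1 i2 i3 i4 iE (40 * (1 + ηc)) ((2 * ((14 * (QG) ^ 2 * dO ^ 2 + 8 * (QG) ^ 2 * m ^ 2) * Λ₁ + 4 * (QG) ^ 2 * (CB)) * m ^ 2 * Λ₁ + ((14 * (QG) ^ 2 * dO ^ 2 + 8 * (QG) ^ 2 * m ^ 2) * Λ₁ + 4 * (QG) ^ 2 * (CB)) * (CB))) ((((3 * (KN) ^ 2 * β + 8 * ((KN) ^ 2 * β ^ 2 * (AL) ^ 2) * m ^ 2) * Λ₁ + 4 * ((KN) ^ 2 * β ^ 2 * (AL) ^ 2) * (CB) + 2 * (20 * ((KN) ^ 2 * β ^ 2 * (AL)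 ^ 2) * Λ₁) * m ^ 2) * Λ₁ + (20 * ((KN) ^ 2 * β ^ 2 * (AL) ^ 2) * Λ₁) * (CB))) ((54 * c₂ ^ 2 * Λ₁ * Λ₁))
    (((((KN) ^ 2 * β + 4 * ((KN) ^ 2 * β ^ 2 * (AL) ^ 2) * m ^ 2) * Λ₁ + 2 * ((KN) ^ 2 * β ^ 2 * (AL) ^ 2) * (CB) + 16 * ((KN) ^ 2 * β ^ 2 * (AL) ^ 2) * Λ₁ * m ^ 2) * Λ₁ + 8 * ((KN) ^ 2 * β ^ 2 * (AL) ^ 2) * Λ₁ * (CB))) ((18 * c₂ ^ 2 * Λ₁ * Λ₁)) ((4 * ηc ^ 2 * cq * a₀' * Λ₁ * Λ₁)) ((2 * ((14 * (QG) ^ 2 * dO ^ 2 + 8 * (QG) ^ 2 * m ^ 2) * Λ₁ + 4 * (QG) ^ 2 * (CB)) * Λ₁)) ((2 * (20 * ((KN) ^ 2 * β ^ 2 * (AL) ^ 2) * Λ₁) * Λ₁)) ((16 * ((KN) ^ 2 * β ^ 2 * (AL) ^ 2) * Λ₁ * Λ₁)) φ2 ψ2 (K1 ^ 2)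
  have hint : Integrable (fun x => (((40 * (1 + ηc) * ((2 * ((14 * (QG) ^ 2 * dO ^ 2 + 8 * (QG) ^ 2 * m ^ 2) * Λ₁ + 4 * (QG) ^ 2 * (CB)) * m ^ 2 * Λ₁ + ((14 * (QG) ^ 2 * dO ^ 2 + 8 * (QG) ^ 2 * m ^ 2) * Λ₁ + 4 * (QG) ^ 2 * (CB)) * (CB)) * (w x * Y0 x) + (((3 * (KN) ^ 2 * β + 8 * ((KN) ^ 2 * β ^ 2 * (AL) ^ 2) * m ^ 2) * Λ₁ + 4 * ((KN) ^ 2 * β ^ 2 * (AL) ^ 2) * (CB) + 2 * (20 * ((KN) ^ 2 * β ^ 2 * (AL) ^ 2) * Λ₁) * m ^ 2) * Λ₁ + (20 * ((KN) ^ 2 * β ^ 2 * (AL) ^ 2) * Λ₁) * (CB)) * (w x * n x ^ 2 * Y0 x) + (54 * c₂ ^ 2 * Λ₁ * Λ₁) * (w x * n x ^ 4 * Y0 x) + ((((KN) ^ 2 * β + 4 * ((KN) ^ 2 * β ^ 2 * (AL) ^ 2) * m ^ 2) * Λ₁ + 2 * ((KN) ^ 2 * β ^ 2 * (AL) ^ 2)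 * (CB) + 16 * ((KN) ^ 2 * β ^ 2 * (AL) ^ 2) * Λ₁ * m ^ 2) * Λ₁ + 8 * ((KN) ^ 2 * β ^ 2 * (AL) ^ 2) * Λ₁ * (CB)) * ((w x * Y1 x) + (w x * Y2 x)) + (18 * c₂ ^ 2 * Λ₁ * Λ₁) * ((w x * Y3 x) + (w x * Y4 x))) + (4 * ηc ^ 2 * cq * a₀' * Λ₁ * Λ₁) * (w x * E x)) * φ2 +
          40 * (1 + ηc) * ((2 * ((14 * (QG) ^ 2 * dO ^ 2 + 8 * (QG) ^ 2 * m ^ 2) * Λ₁ + 4 * (QG) ^ 2 * (CB)) * Λ₁) * (w x * Y0 x) + (2 * (20 * ((KN) ^ 2 * β ^ 2 * (AL) ^ 2) * Λ₁) * Λ₁) * (w x * n x ^ 2 * Y0 x) + (16 * ((KN) ^ 2 * β ^ 2 * (AL) ^ 2) * Λ₁ * Λ₁) * ((w x * Y1 x) + (w x * Y2 x))) * ψ2)) / K1 ^ 2) μ := by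
    have e : ∀ x, (((40 * (1 + ηc) * ((2 * ((14 * (QG) ^ 2 * dO ^ 2 + 8 * (QG) ^ 2 * m ^ 2) * Λ₁ + 4 * (QG) ^ 2 * (CB)) * m ^ 2 * Λ₁ + ((14 * (QG) ^ 2 * dO ^ 2 + 8 * (QG) ^ 2 * m ^ 2) * Λ₁ + 4 * (QG) ^ 2 * (CB)) * (CB)) * (w x * Y0 x) + (((3 * (KN) ^ 2 * β + 8 * ((KN) ^ 2 * β ^ 2 * (AL) ^ 2) * m ^ 2) * Λ₁ + 4 * ((KN) ^ 2 * β ^ 2 * (AL) ^ 2) * (CB) + 2 * (20 * ((KN) ^ 2 * β ^ 2 * (AL) ^ 2) * Λ₁) * m ^ 2) * Λ₁ + (20 * ((KN) ^ 2 * β ^ 2 * (AL) ^ 2) * Λ₁) * (CB)) * (w x * n x ^ 2 * Y0 x) + (54 * c₂ ^ 2 * Λ₁ * Λ₁) * (w x * n x ^ 4 * Y0 x) + ((((KN) ^ 2 * β + 4 * ((KN) ^ 2 * β ^ 2 * (AL) ^ 2) * m ^ 2) * Λ₁ + 2 * ((KN) ^ 2 * β ^ 2 * (AL) ^ 2) *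 (CB) + 16 * ((KN) ^ 2 * β ^ 2 * (AL) ^ 2) * Λ₁ * m ^ 2) * Λ₁ + 8 * ((KN) ^ 2 * β ^ 2 * (AL) ^ 2) * Λ₁ * (CB)) * ((w x * Y1 x) + (w x * Y2 x)) + (18 * c₂ ^ 2 * Λ₁ * Λ₁) * ((w x * Y3 x) + (w x * Y4 x))) + (4 * ηc ^ 2 * cq * a₀' * Λ₁ * Λ₁) * (w x * E x)) * φ2 +
          40 * (1 + ηc) * ((2 * ((14 * (QG) ^ 2 * dO ^ 2 + 8 * (QG) ^ 2 * m ^ 2) * Λ₁ + 4 * (QG) ^ 2 * (CB)) * Λ₁) * (w x * Y0 x) + (2 * (20 * ((KN) ^ 2 * β ^ 2 * (AL) ^ 2) * Λ₁) * Λ₁) * (w x * n x ^ 2 * Y0 x) + (16 * ((KN) ^ 2 * β ^ 2 * (AL) ^ 2) * Λ₁ * Λ₁) * ((w x * Y1 x) + (w x * Y2 x))) * ψ2)) / K1 ^ 2 =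
        (((40 * (1 + ηc)) * (2 * ((14 * (QG) ^ 2 * dO ^ 2 + 8 * (QG) ^ 2 * m ^ 2) * Λ₁ + 4 * (QG) ^ 2 * (CB)) * m ^ 2 * Λ₁ + ((14 * (QG) ^ 2 * dO ^ 2 + 8 * (QG) ^ 2 * m ^ 2) * Λ₁ + 4 * (QG) ^ 2 * (CB)) * (CB)) * φ2 + (40 * (1 + ηc)) * (2 * ((14 * (QG) ^ 2 * dO ^ 2 + 8 * (QG) ^ 2 * m ^ 2) * Λ₁ + 4 * (QG) ^ 2 * (CB)) * Λ₁) * ψ2) / K1 ^ 2) * (w x * Y0 x) +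
        (((40 * (1 + ηc)) * (((3 * (KN) ^ 2 * β + 8 * ((KN) ^ 2 * β ^ 2 * (AL) ^ 2) * m ^ 2) * Λ₁ + 4 * ((KN) ^ 2 * β ^ 2 * (AL) ^ 2) * (CB) + 2 * (20 * ((KN) ^ 2 * β ^ 2 * (AL) ^ 2) * Λ₁) * m ^ 2) * Λ₁ + (20 * ((KN) ^ 2 * β ^ 2 * (AL) ^ 2) * Λ₁) * (CB)) * φ2 + (40 * (1 + ηc)) * (2 * (20 * ((KN) ^ 2 * β ^ 2 * (AL) ^ 2) * Λ₁) * Λ₁) * ψ2) / K1 ^ 2) * (w x * n x ^ 2 * Y0 x) +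
        (((40 * (1 + ηc)) * (54 * c₂ ^ 2 * Λ₁ * Λ₁) * φ2) / K1 ^ 2) * (w x * n x ^ 4 * Y0 x) +
        (((40 * (1 + ηc)) * ((((KN) ^ 2 * β + 4 * ((KN) ^ 2 * β ^ 2 * (AL) ^ 2) * m ^ 2) * Λ₁ + 2 * ((KN) ^ 2 * β ^ 2 * (AL) ^ 2) * (CB) + 16 * ((KN) ^ 2 * β ^ 2 * (AL) ^ 2) * Λ₁ * m ^ 2) * Λ₁ + 8 * ((KN) ^ 2 * β ^ 2 * (AL) ^ 2) * Λ₁ * (CB)) * φ2 + (40 * (1 + ηc)) * (16 * ((KN) ^ 2 * β ^ 2 * (AL) ^ 2) * Λ₁ * Λ₁) * ψ2) / K1 ^ 2) * (w x * Y1 x) +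
        (((40 * (1 + ηc)) * ((((KN) ^ 2 * β + 4 * ((KN) ^ 2 * β ^ 2 * (AL) ^ 2) * m ^ 2) * Λ₁ + 2 * ((KN) ^ 2 * β ^ 2 * (AL) ^ 2) * (CB) + 16 * ((KN) ^ 2 * β ^ 2 * (AL) ^ 2) * Λ₁ * m ^ 2) * Λ₁ + 8 * ((KN) ^ 2 * β ^ 2 * (AL) ^ 2) * Λ₁ * (CB)) * φ2 + (40 * (1 + ηc)) * (16 * ((KN) ^ 2 * β ^ 2 * (AL) ^ 2) * Λ₁ * Λ₁) * ψ2) / K1 ^ 2) * (w x * Y2 x) +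
        (((40 * (1 + ηc)) * (18 * c₂ ^ 2 * Λ₁ * Λ₁) * φ2) / K1 ^ 2) * (w x * Y3 x) +
        (((40 * (1 + ηc)) * (18 * c₂ ^ 2 * Λ₁ * Λ₁) * φ2) / K1 ^ 2) * (w x * Y4 x) +
        (((4 * ηc ^ 2 * cq * a₀' * Λ₁ * Λ₁) * φ2) / K1 ^ 2) * (w x * E x) := fun x => by ring
    simp_rw [e]
    exact (((((((i00.const_mul _).add (i02.const_mul _)).add (i04.const_mul _)).add (i1.const_mul _)).add (i2.const_mul _)).add
      (i3.const_mul _)).add (i4.const_mul _)).add (iE.const_mul _)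
  have hmono := integral_mono_of_nonneg (μ := μ) (ae_of_all _ fun x => ?_) hint (ae_of_all _ hpt)
  · exact hmono.trans (le_of_eq hlin)
  -- `0 ≤ w · SB`
  have hs : 0 ≤ min (n x) (Rin ^ 2) := le_min (hn x) (sq_nonneg _)
  have h0 := (hY0 x).1; have h1 := (hY1 x).1; have h2 := (hY2 x).1; have h3 := (hY3 x).1; have h4 := (hY4 x).1; have hE0 := (hE x).1
  have hw0 := (hw x).1
  positivity

/-! ## §4 ★★ The same split for any dominated integrand -/

set_option maxRecDepth 4096 in
set_option maxHeartbeats 4000000 in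
-- as §3, for any integrand dominated pointwise by `w·SB` (of record: `w·S` with `S ≤ SB` by `slow_side_le`).
/-- ★★ **THE SPLIT, FOR ANY INTEGRAND DOMINATED BY `w·SB`**: if `0 ≤ Φ ≤ w·SB/K₁²` pointwise then `∫Φ ≤` the eight-fibre-factor combination of §3
(no integrability hypothesis on `Φ`; data as in `integral_weight_mul_slow_bound_le_split`). [folklore] -/
theorem integral_le_slow_bound_split_of_le {α : Type*} [MeasurableSpace α] {μ : Measure α} [IsFiniteMeasure μ]
    {Φ w n Y0 Y1 Y2 Y3 Y4 E : α → ℝ} (hwm : Measurable w) (hnm : Measurable n) (hY0m : Measurable Y0) (hY1m : Measurable Y1)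
    (hY2m : Measurable Y2) (hY3m : Measurable Y3) (hY4m : Measurable Y4) (hEm : Measurable E)
    {Cw N B0 B1 B2 B3 B4 BE : ℝ} (hw : ∀ x, 0 ≤ w x ∧ w x ≤ Cw) (hn : ∀ x, 0 ≤ n x) (hwn : ∀ x, w x ≠ 0 → n x ≤ N)
    (hY0 : ∀ x, 0 ≤ Y0 x ∧ Y0 x ≤ B0) (hY1 : ∀ x, 0 ≤ Y1 x ∧ Y1 x ≤ B1) (hY2 : ∀ x, 0 ≤ Y2 x ∧ Y2 x ≤ B2) (hY3 : ∀ x, 0 ≤ Y3 x ∧ Y3 x ≤ B3)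
    (hY4 : ∀ x, 0 ≤ Y4 x ∧ Y4 x ≤ B4) (hE : ∀ x, 0 ≤ E x ∧ E x ≤ BE)
    {KN AL CB QG Λ₁ K1 φ2 ψ2 β c₂ m dO Rin ηc cq a₀' : ℝ} (hΛ : 0 ≤ Λ₁) (hCB : 0 ≤ CB) (hβ : 0 ≤ β) (hφ2 : 0 ≤ φ2) (hψ2 : 0 ≤ ψ2)
    (hη : 0 ≤ ηc)
    (hΦ : ∀ x, 0 ≤ Φ x ∧ Φ x ≤ w x * ((40 * (1 + ηc) *
            ((Y0 x) *
                (((((2 * (3 / 2 * (KN) ^ 2 * β * (min (n x) (Rin ^ 2)) ^ 2 + 27 * c₂ ^ 2 * (min (n x) (Rin ^ 2)) ^ 4) + 4 * (2 * (KN) ^ 2 * β ^ 2 * (AL) ^ 2 * (min (n x) (Rin ^ 2)) ^ 2) * m ^ 2) * Λ₁ + 2 * (2 * (KN) ^ 2 * β ^ 2 * (AL) ^ 2 * (min (n x) (Rin ^ 2)) ^ 2) * (CB)) +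
              2 * ((2 * (3 * (QG) ^ 2 * dO ^ 2 + 6 * (KN) ^ 2 * β ^ 2 * (AL) ^ 2 * (min (n x) (Rin ^ 2)) ^ 2) + 4 * ((2 * (KN) ^ 2 * β ^ 2 * (AL) ^ 2 * (min (n x) (Rin ^ 2)) ^ 2) + (2 * (QG) ^ 2) * dO ^ 2 + (2 * (QG) ^ 2) * m ^ 2)) * Λ₁ + 2 * (2 * (QG) ^ 2) * (CB)) * m ^ 2) * Λ₁ +
            ((2 * (3 * (QG) ^ 2 * dO ^ 2 + 6 * (KN) ^ 2 * β ^ 2 * (AL) ^ 2 * (min (n x) (Rin ^ 2)) ^ 2) + 4 * ((2 * (KN) ^ 2 * β ^ 2 * (AL) ^ 2 * (min (n x) (Rin ^ 2)) ^ 2) + (2 * (QG) ^ 2) * dO ^ 2 + (2 * (QG) ^ 2) * m ^ 2)) * Λ₁ + 2 * (2 * (QG) ^ 2) * (CB)) *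
              (CB)) * φ2 +
          2 * ((2 * (3 * (QG) ^ 2 * dO ^ 2 + 6 * (KN) ^ 2 * β ^ 2 * (AL) ^ 2 * (min (n x) (Rin ^ 2)) ^ 2) + 4 * ((2 * (KN) ^ 2 * β ^ 2 * (AL) ^ 2 * (min (n x) (Rin ^ 2)) ^ 2) + (2 * (QG) ^ 2) * dO ^ 2 + (2 * (QG) ^ 2) * m ^ 2)) * Λ₁ + 2 * (2 * (QG) ^ 2) * (CB)) * Λ₁ *
            ψ2) +
              ((Y1 x) + (Y2 x)) *
                (((((2 * (KN) ^ 2 * β / 2 + 4 * (KN) ^ 2 * β ^ 2 * (AL) ^ 2 * m ^ 2) * Λ₁ + 2 * (KN) ^ 2 * β ^ 2 * (AL) ^ 2 * (CB)) +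
              2 * ((2 * 2 * (KN) ^ 2 * β ^ 2 * (AL) ^ 2 + 4 * ((KN) ^ 2 * β ^ 2 * (AL) ^ 2 + 0 * dO ^ 2 + 0 * m ^ 2)) * Λ₁ + 2 * 0 * (CB)) * m ^ 2) * Λ₁ +
            ((2 * 2 * (KN) ^ 2 * β ^ 2 * (AL) ^ 2 + 4 * ((KN) ^ 2 * β ^ 2 * (AL) ^ 2 + 0 * dO ^ 2 + 0 * m ^ 2)) * Λ₁ + 2 * 0 * (CB)) *
              (CB)) * φ2 +
          2 * ((2 * 2 * (KN) ^ 2 * β ^ 2 * (AL) ^ 2 + 4 * ((KN) ^ 2 * β ^ 2 * (AL) ^ 2 + 0 * dO ^ 2 + 0 * m ^ 2)) * Λ₁ + 2 * 0 * (CB)) * Λ₁ *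
            ψ2) +
              9 * c₂ ^ 2 * ((Y3 x) + (Y4 x)) *
                (2 * Λ₁ * Λ₁ * φ2)) +
          2 * ηc ^ 2 * (cq * (a₀' * E x)) * (2 * Λ₁ * Λ₁ * φ2)) /
        K1 ^ 2)) :
    ∫ x, Φ x ∂μ ≤
      (((40 * (1 + ηc) * ((2 * ((14 * (QG) ^ 2 * dO ^ 2 + 8 * (QG) ^ 2 * m ^ 2) * Λ₁ + 4 * (QG) ^ 2 * (CB)) * m ^ 2 * Λ₁ + ((14 * (QG) ^ 2 * dO ^ 2 + 8 * (QG) ^ 2 * m ^ 2) * Λ₁ + 4 * (QG) ^ 2 * (CB)) * (CB)) * (∫ x, w x * Y0 x ∂μ) + (((3 * (KN) ^ 2 * β + 8 * ((KN) ^ 2 * β ^ 2 * (AL) ^ 2) * m ^ 2) * Λ₁ + 4 * ((KN) ^ 2 * β ^ 2 * (AL) ^ 2) * (CB) + 2 * (20 * ((KN) ^ 2 * β ^ 2 * (AL) ^ 2) * Λ₁) * m ^ 2) * Λ₁ + (20 * ((KN) ^ 2 * β ^ 2 * (AL) ^ 2) * Λ₁) * (CB)) * (∫ x, w x * n x ^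 2 * Y0 x ∂μ) + (54 * c₂ ^ 2 * Λ₁ * Λ₁) * (∫ x, w x * n x ^ 4 * Y0 x ∂μ) + ((((KN) ^ 2 * β + 4 * ((KN) ^ 2 * β ^ 2 * (AL) ^ 2) * m ^ 2) * Λ₁ + 2 * ((KN) ^ 2 * β ^ 2 * (AL) ^ 2) * (CB) + 16 * ((KN) ^ 2 * β ^ 2 * (AL) ^ 2) * Λ₁ * m ^ 2) * Λ₁ + 8 * ((KN) ^ 2 * β ^ 2 * (AL) ^ 2) * Λ₁ * (CB)) * ((∫ x, w x * Y1 x ∂μ) + (∫ x, w x * Y2 x ∂μ)) + (18 * c₂ ^ 2 * Λ₁ * Λ₁) * ((∫ x, w x * Y3 x ∂μ) + (∫ x, w x * Y4 x ∂μ))) + (4 * ηc ^ 2 * cq * a₀' * Λ₁ * Λ₁) * (∫ x, w x * E x ∂μ)) * φ2 +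
          40 * (1 + ηc) * ((2 * ((14 * (QG) ^ 2 * dO ^ 2 + 8 * (QG) ^ 2 * m ^ 2) * Λ₁ + 4 * (QG) ^ 2 * (CB)) * Λ₁) * (∫ x, w x * Y0 x ∂μ) + (2 * (20 * ((KN) ^ 2 * β ^ 2 * (AL) ^ 2) * Λ₁) * Λ₁) * (∫ x, w x * n x ^ 2 * Y0 x ∂μ) + (16 * ((KN) ^ 2 * β ^ 2 * (AL) ^ 2) * Λ₁ * Λ₁) * ((∫ x, w x * Y1 x ∂μ) + (∫ x, w x * Y2 x ∂μ))) * ψ2)) /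
        K1 ^ 2 := by
  -- the eight integrable monomials
  have hone : ∀ x, 0 ≤ (fun _ : α => (1 : ℝ)) x ∧ (fun _ : α => (1 : ℝ)) x ≤ 1 := fun _ => ⟨zero_le_one, le_rfl⟩
  have hn1 : ∀ x, w x ≠ 0 → (fun _ : α => (1 : ℝ)) x ≤ 1 := fun _ _ => le_rfl
  have i00 : Integrable (fun x => w x * Y0 x) μ := by
    have h := integrable_weight_mul_pow_mul (μ := μ) hwm measurable_const hY0m hw (fun x => (hone x).1) hn1 hY0 0
    simpa only [pow_zero, mul_one] using h
  have i02 : Integrable (fun x => w x * n x ^ 2 * Y0 x) μ := integrable_weight_mul_pow_mul (μ := μ) hwm hnm hY0m hw hn hwn hY0 2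
  have i04 : Integrable (fun x => w x * n x ^ 4 * Y0 x) μ := integrable_weight_mul_pow_mul (μ := μ) hwm hnm hY0m hw hn hwn hY0 4
  have i1 : Integrable (fun x => w x * Y1 x) μ := by
    have h := integrable_weight_mul_pow_mul (μ := μ) hwm measurable_const hY1m hw (fun x => (hone x).1) hn1 hY1 0
    simpa only [pow_zero, mul_one] using h
  have i2 : Integrable (fun x => w x * Y2 x) μ := by
    have h := integrable_weight_mul_pow_mul (μ := μ) hwm measurable_const hY2m hw (fun x => (hone x).1) hn1 hY2 0
    simpa only [pow_zero, mul_one] using h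
  have i3 : Integrable (fun x => w x * Y3 x) μ := by
    have h := integrable_weight_mul_pow_mul (μ := μ) hwm measurable_const hY3m hw (fun x => (hone x).1) hn1 hY3 0
    simpa only [pow_zero, mul_one] using h
  have i4 : Integrable (fun x => w x * Y4 x) μ := by
    have h := integrable_weight_mul_pow_mul (μ := μ) hwm measurable_const hY4m hw (fun x => (hone x).1) hn1 hY4 0
    simpa only [pow_zero, mul_one] using h
  have iE : Integrable (fun x => w x * E x) μ := by
    have h := integrable_weight_mul_pow_mul (μ := μ) hwm measurable_const hEm hw (fun x => (hone x).1) hn1 hE 0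
    simpa only [pow_zero, mul_one] using h
  -- the pointwise split
  have hpt : ∀ x, w x * ((40 * (1 + ηc) *
            ((Y0 x) *
                (((((2 * (3 / 2 * (KN) ^ 2 * β * (min (n x) (Rin ^ 2)) ^ 2 + 27 * c₂ ^ 2 * (min (n x) (Rin ^ 2)) ^ 4) + 4 * (2 * (KN) ^ 2 * β ^ 2 * (AL) ^ 2 * (min (n x) (Rin ^ 2)) ^ 2) * m ^ 2) * Λ₁ + 2 * (2 * (KN) ^ 2 * β ^ 2 * (AL) ^ 2 * (min (n x) (Rin ^ 2)) ^ 2) * (CB)) +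
              2 * ((2 * (3 * (QG) ^ 2 * dO ^ 2 + 6 * (KN) ^ 2 * β ^ 2 * (AL) ^ 2 * (min (n x) (Rin ^ 2)) ^ 2) + 4 * ((2 * (KN) ^ 2 * β ^ 2 * (AL) ^ 2 * (min (n x) (Rin ^ 2)) ^ 2) + (2 * (QG) ^ 2) * dO ^ 2 + (2 * (QG) ^ 2) * m ^ 2)) * Λ₁ + 2 * (2 * (QG) ^ 2) * (CB)) * m ^ 2) * Λ₁ +
            ((2 * (3 * (QG) ^ 2 * dO ^ 2 + 6 * (KN) ^ 2 * β ^ 2 * (AL) ^ 2 * (min (n x) (Rin ^ 2)) ^ 2) + 4 * ((2 * (KN) ^ 2 * β ^ 2 * (AL) ^ 2 * (min (n x) (Rin ^ 2)) ^ 2) + (2 * (QG) ^ 2) * dO ^ 2 + (2 * (QG) ^ 2) * m ^ 2)) * Λ₁ + 2 * (2 * (QG) ^ 2) * (CB)) *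
              (CB)) * φ2 +
          2 * ((2 * (3 * (QG) ^ 2 * dO ^ 2 + 6 * (KN) ^ 2 * β ^ 2 * (AL) ^ 2 * (min (n x) (Rin ^ 2)) ^ 2) + 4 * ((2 * (KN) ^ 2 * β ^ 2 * (AL) ^ 2 * (min (n x) (Rin ^ 2)) ^ 2) + (2 * (QG) ^ 2) * dO ^ 2 + (2 * (QG) ^ 2) * m ^ 2)) * Λ₁ + 2 * (2 * (QG) ^ 2) * (CB)) * Λ₁ *
            ψ2) +
              ((Y1 x) + (Y2 x)) *
                (((((2 * (KN) ^ 2 * β / 2 + 4 * (KN) ^ 2 * β ^ 2 * (AL) ^ 2 * m ^ 2) * Λ₁ + 2 * (KN) ^ 2 * β ^ 2 * (AL) ^ 2 * (CB)) +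
              2 * ((2 * 2 * (KN) ^ 2 * β ^ 2 * (AL) ^ 2 + 4 * ((KN) ^ 2 * β ^ 2 * (AL) ^ 2 + 0 * dO ^ 2 + 0 * m ^ 2)) * Λ₁ + 2 * 0 * (CB)) * m ^ 2) * Λ₁ +
            ((2 * 2 * (KN) ^ 2 * β ^ 2 * (AL) ^ 2 + 4 * ((KN) ^ 2 * β ^ 2 * (AL) ^ 2 + 0 * dO ^ 2 + 0 * m ^ 2)) * Λ₁ + 2 * 0 * (CB)) *
              (CB)) * φ2 +
          2 * ((2 * 2 * (KN) ^ 2 * β ^ 2 * (AL) ^ 2 + 4 * ((KN) ^ 2 * β ^ 2 * (AL) ^ 2 + 0 * dO ^ 2 + 0 * m ^ 2)) * Λ₁ + 2 * 0 * (CB)) * Λ₁ *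
            ψ2) +
              9 * c₂ ^ 2 * ((Y3 x) + (Y4 x)) *
                (2 * Λ₁ * Λ₁ * φ2)) +
          2 * ηc ^ 2 * (cq * (a₀' * E x)) * (2 * Λ₁ * Λ₁ * φ2)) / K1 ^ 2) ≤
      (((40 * (1 + ηc) * ((2 * ((14 * (QG) ^ 2 * dO ^ 2 + 8 * (QG) ^ 2 * m ^ 2) * Λ₁ + 4 * (QG) ^ 2 * (CB)) * m ^ 2 * Λ₁ + ((14 * (QG) ^ 2 * dO ^ 2 + 8 * (QG) ^ 2 * m ^ 2) * Λ₁ + 4 * (QG) ^ 2 * (CB)) * (CB)) * (w x * Y0 x) + (((3 * (KN) ^ 2 * β + 8 * ((KN) ^ 2 * β ^ 2 * (AL) ^ 2) * m ^ 2) * Λ₁ + 4 * ((KN) ^ 2 * β ^ 2 * (AL) ^ 2) * (CB) + 2 * (20 * ((KN) ^ 2 * β ^ 2 * (AL) ^ 2) * Λ₁) * m ^ 2) * Λ₁ + (20 * ((KN) ^ 2 * β ^ 2 * (AL) ^ 2) * Λ₁) * (CB)) * (w x * n x ^ 2 * Y0 x) + (54 * c₂ ^ 2 * Λ₁ * Λ₁)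 * (w x * n x ^ 4 * Y0 x) + ((((KN) ^ 2 * β + 4 * ((KN) ^ 2 * β ^ 2 * (AL) ^ 2) * m ^ 2) * Λ₁ + 2 * ((KN) ^ 2 * β ^ 2 * (AL) ^ 2) * (CB) + 16 * ((KN) ^ 2 * β ^ 2 * (AL) ^ 2) * Λ₁ * m ^ 2) * Λ₁ + 8 * ((KN) ^ 2 * β ^ 2 * (AL) ^ 2) * Λ₁ * (CB)) * ((w x * Y1 x) + (w x * Y2 x)) + (18 * c₂ ^ 2 * Λ₁ * Λ₁) * ((w x * Y3 x) + (w x * Y4 x))) + (4 * ηc ^ 2 * cq * a₀' * Λ₁ * Λ₁) * (w x * E x)) * φ2 +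
          40 * (1 + ηc) * ((2 * ((14 * (QG) ^ 2 * dO ^ 2 + 8 * (QG) ^ 2 * m ^ 2) * Λ₁ + 4 * (QG) ^ 2 * (CB)) * Λ₁) * (w x * Y0 x) + (2 * (20 * ((KN) ^ 2 * β ^ 2 * (AL) ^ 2) * Λ₁) * Λ₁) * (w x * n x ^ 2 * Y0 x) + (16 * ((KN) ^ 2 * β ^ 2 * (AL) ^ 2) * Λ₁ * Λ₁) * ((w x * Y1 x) + (w x * Y2 x))) * ψ2)) / K1 ^ 2 := fun x => by
    have hs : 0 ≤ min (n x) (Rin ^ 2) := le_min (hn x) (sq_nonneg _)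
    have h := slow_bound_mul_le_split (KN := KN) (AL := AL) (QG := QG) (c₂ := c₂) (m := m) (dO := dO) (cq := cq) (a₀' := a₀')
      (Y1 := Y1 x) (Y2 := Y2 x) (Y3 := Y3 x) (Y4 := Y4 x) (E := E x) hs (min_le_left _ _) (hw x).1 (hY0 x).1 hΛ hCB hβ hφ2 hψ2 hη
    rw [mul_div_assoc']
    exact div_le_div_of_nonneg_right h (sq_nonneg _)
  -- integrate
  have hlin := integral_lin8_div i00 i02 i04 i1 i2 i3 i4 iE (40 * (1 + ηc)) ((2 * ((14 * (QG) ^ 2 * dO ^ 2 + 8 * (QG) ^ 2 * m ^ 2) * Λ₁ + 4 * (QG) ^ 2 * (CB)) * m ^ 2 * Λ₁ + ((14 * (QG) ^ 2 * dO ^ 2 + 8 * (QG) ^ 2 * m ^ 2) * Λ₁ + 4 * (QG) ^ 2 * (CB)) * (CB))) ((((3 * (KN) ^ 2 * β + 8 * ((KN) ^ 2 * β ^ 2 * (AL) ^ 2) * m ^ 2) * Λ₁ + 4 * ((KN) ^ 2 * β ^ 2 * (AL) ^ 2) * (CB) + 2 * (20 * ((KN) ^ 2 * β ^ 2 * (AL)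 ^ 2) * Λ₁) * m ^ 2) * Λ₁ + (20 * ((KN) ^ 2 * β ^ 2 * (AL) ^ 2) * Λ₁) * (CB))) ((54 * c₂ ^ 2 * Λ₁ * Λ₁))
    (((((KN) ^ 2 * β + 4 * ((KN) ^ 2 * β ^ 2 * (AL) ^ 2) * m ^ 2) * Λ₁ + 2 * ((KN) ^ 2 * β ^ 2 * (AL) ^ 2) * (CB) + 16 * ((KN) ^ 2 * β ^ 2 * (AL) ^ 2) * Λ₁ * m ^ 2) * Λ₁ + 8 * ((KN) ^ 2 * β ^ 2 * (AL) ^ 2) * Λ₁ * (CB))) ((18 * c₂ ^ 2 * Λ₁ * Λ₁)) ((4 * ηc ^ 2 * cq * a₀' * Λ₁ * Λ₁)) ((2 * ((14 * (QG) ^ 2 * dO ^ 2 + 8 * (QG) ^ 2 * m ^ 2) * Λ₁ + 4 * (QG) ^ 2 * (CB)) * Λ₁)) ((2 * (20 * ((KN) ^ 2 * β ^ 2 * (AL) ^ 2) * Λ₁) * Λ₁)) ((16 * ((KN) ^ 2 * β ^ 2 * (AL) ^ 2) * Λ₁ * Λ₁)) φ2 ψ2 (K1 ^ 2)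
  have hint : Integrable (fun x => (((40 * (1 + ηc) * ((2 * ((14 * (QG) ^ 2 * dO ^ 2 + 8 * (QG) ^ 2 * m ^ 2) * Λ₁ + 4 * (QG) ^ 2 * (CB)) * m ^ 2 * Λ₁ + ((14 * (QG) ^ 2 * dO ^ 2 + 8 * (QG) ^ 2 * m ^ 2) * Λ₁ + 4 * (QG) ^ 2 * (CB)) * (CB)) * (w x * Y0 x) + (((3 * (KN) ^ 2 * β + 8 * ((KN) ^ 2 * β ^ 2 * (AL) ^ 2) * m ^ 2) * Λ₁ + 4 * ((KN) ^ 2 * β ^ 2 * (AL) ^ 2) * (CB) + 2 * (20 * ((KN) ^ 2 * β ^ 2 * (AL) ^ 2) * Λ₁) * m ^ 2) * Λ₁ + (20 * ((KN) ^ 2 * β ^ 2 * (AL) ^ 2) * Λ₁) * (CB)) * (w x * n x ^ 2 * Y0 x) + (54 * c₂ ^ 2 * Λ₁ * Λ₁) * (w x * n x ^ 4 * Y0 x) + ((((KN) ^ 2 * β + 4 * ((KN) ^ 2 * β ^ 2 * (AL) ^ 2) * m ^ 2) * Λ₁ + 2 * ((KN) ^ 2 * β ^ 2 * (AL) ^ 2)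 * (CB) + 16 * ((KN) ^ 2 * β ^ 2 * (AL) ^ 2) * Λ₁ * m ^ 2) * Λ₁ + 8 * ((KN) ^ 2 * β ^ 2 * (AL) ^ 2) * Λ₁ * (CB)) * ((w x * Y1 x) + (w x * Y2 x)) + (18 * c₂ ^ 2 * Λ₁ * Λ₁) * ((w x * Y3 x) + (w x * Y4 x))) + (4 * ηc ^ 2 * cq * a₀' * Λ₁ * Λ₁) * (w x * E x)) * φ2 +
          40 * (1 + ηc) * ((2 * ((14 * (QG) ^ 2 * dO ^ 2 + 8 * (QG) ^ 2 * m ^ 2) * Λ₁ + 4 * (QG) ^ 2 * (CB)) * Λ₁) * (w x * Y0 x) + (2 * (20 * ((KN) ^ 2 * β ^ 2 * (AL) ^ 2) * Λ₁) * Λ₁) * (w x * n x ^ 2 * Y0 x) + (16 * ((KN) ^ 2 * β ^ 2 * (AL) ^ 2) * Λ₁ * Λ₁) * ((w x * Y1 x) + (w x * Y2 x))) * ψ2)) / K1 ^ 2) μ := by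
    have e : ∀ x, (((40 * (1 + ηc) * ((2 * ((14 * (QG) ^ 2 * dO ^ 2 + 8 * (QG) ^ 2 * m ^ 2) * Λ₁ + 4 * (QG) ^ 2 * (CB)) * m ^ 2 * Λ₁ + ((14 * (QG) ^ 2 * dO ^ 2 + 8 * (QG) ^ 2 * m ^ 2) * Λ₁ + 4 * (QG) ^ 2 * (CB)) * (CB)) * (w x * Y0 x) + (((3 * (KN) ^ 2 * β + 8 * ((KN) ^ 2 * β ^ 2 * (AL) ^ 2) * m ^ 2) * Λ₁ + 4 * ((KN) ^ 2 * β ^ 2 * (AL) ^ 2) * (CB) + 2 * (20 * ((KN) ^ 2 * β ^ 2 * (AL) ^ 2) * Λ₁) * m ^ 2) * Λ₁ + (20 * ((KN) ^ 2 * β ^ 2 * (AL) ^ 2) * Λ₁) * (CB)) * (w x * n x ^ 2 * Y0 x) + (54 * c₂ ^ 2 * Λ₁ * Λ₁) * (w x * n x ^ 4 * Y0 x) + ((((KN) ^ 2 * β + 4 * ((KN) ^ 2 * β ^ 2 * (AL) ^ 2) * m ^ 2) * Λ₁ + 2 * ((KN) ^ 2 * β ^ 2 * (AL) ^ 2) *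 (CB) + 16 * ((KN) ^ 2 * β ^ 2 * (AL) ^ 2) * Λ₁ * m ^ 2) * Λ₁ + 8 * ((KN) ^ 2 * β ^ 2 * (AL) ^ 2) * Λ₁ * (CB)) * ((w x * Y1 x) + (w x * Y2 x)) + (18 * c₂ ^ 2 * Λ₁ * Λ₁) * ((w x * Y3 x) + (w x * Y4 x))) + (4 * ηc ^ 2 * cq * a₀' * Λ₁ * Λ₁) * (w x * E x)) * φ2 +
          40 * (1 + ηc) * ((2 * ((14 * (QG) ^ 2 * dO ^ 2 + 8 * (QG) ^ 2 * m ^ 2) * Λ₁ + 4 * (QG) ^ 2 * (CB)) * Λ₁) * (w x * Y0 x) + (2 * (20 * ((KN) ^ 2 * β ^ 2 * (AL) ^ 2) * Λ₁) * Λ₁) * (w x * n x ^ 2 * Y0 x) + (16 * ((KN) ^ 2 * β ^ 2 * (AL) ^ 2) * Λ₁ * Λ₁) * ((w x * Y1 x) + (w x * Y2 x))) * ψ2)) / K1 ^ 2 =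
        (((40 * (1 + ηc)) * (2 * ((14 * (QG) ^ 2 * dO ^ 2 + 8 * (QG) ^ 2 * m ^ 2) * Λ₁ + 4 * (QG) ^ 2 * (CB)) * m ^ 2 * Λ₁ + ((14 * (QG) ^ 2 * dO ^ 2 + 8 * (QG) ^ 2 * m ^ 2) * Λ₁ + 4 * (QG) ^ 2 * (CB)) * (CB)) * φ2 + (40 * (1 + ηc)) * (2 * ((14 * (QG) ^ 2 * dO ^ 2 + 8 * (QG) ^ 2 * m ^ 2) * Λ₁ + 4 * (QG) ^ 2 * (CB)) * Λ₁) * ψ2) / K1 ^ 2) * (w x * Y0 x) +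
        (((40 * (1 + ηc)) * (((3 * (KN) ^ 2 * β + 8 * ((KN) ^ 2 * β ^ 2 * (AL) ^ 2) * m ^ 2) * Λ₁ + 4 * ((KN) ^ 2 * β ^ 2 * (AL) ^ 2) * (CB) + 2 * (20 * ((KN) ^ 2 * β ^ 2 * (AL) ^ 2) * Λ₁) * m ^ 2) * Λ₁ + (20 * ((KN) ^ 2 * β ^ 2 * (AL) ^ 2) * Λ₁) * (CB)) * φ2 + (40 * (1 + ηc)) * (2 * (20 * ((KN) ^ 2 * β ^ 2 * (AL) ^ 2) * Λ₁) * Λ₁) * ψ2) / K1 ^ 2) * (w x * n x ^ 2 * Y0 x) +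
        (((40 * (1 + ηc)) * (54 * c₂ ^ 2 * Λ₁ * Λ₁) * φ2) / K1 ^ 2) * (w x * n x ^ 4 * Y0 x) +
        (((40 * (1 + ηc)) * ((((KN) ^ 2 * β + 4 * ((KN) ^ 2 * β ^ 2 * (AL) ^ 2) * m ^ 2) * Λ₁ + 2 * ((KN) ^ 2 * β ^ 2 * (AL) ^ 2) * (CB) + 16 * ((KN) ^ 2 * β ^ 2 * (AL) ^ 2) * Λ₁ * m ^ 2) * Λ₁ + 8 * ((KN) ^ 2 * β ^ 2 * (AL) ^ 2) * Λ₁ * (CB)) * φ2 + (40 * (1 + ηc)) * (16 * ((KN) ^ 2 * β ^ 2 * (AL) ^ 2) * Λ₁ * Λ₁) * ψ2) / K1 ^ 2) * (w x * Y1 x) +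
        (((40 * (1 + ηc)) * ((((KN) ^ 2 * β + 4 * ((KN) ^ 2 * β ^ 2 * (AL) ^ 2) * m ^ 2) * Λ₁ + 2 * ((KN) ^ 2 * β ^ 2 * (AL) ^ 2) * (CB) + 16 * ((KN) ^ 2 * β ^ 2 * (AL) ^ 2) * Λ₁ * m ^ 2) * Λ₁ + 8 * ((KN) ^ 2 * β ^ 2 * (AL) ^ 2) * Λ₁ * (CB)) * φ2 + (40 * (1 + ηc)) * (16 * ((KN) ^ 2 * β ^ 2 * (AL) ^ 2) * Λ₁ * Λ₁) * ψ2) / K1 ^ 2) * (w x * Y2 x) +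
        (((40 * (1 + ηc)) * (18 * c₂ ^ 2 * Λ₁ * Λ₁) * φ2) / K1 ^ 2) * (w x * Y3 x) +
        (((40 * (1 + ηc)) * (18 * c₂ ^ 2 * Λ₁ * Λ₁) * φ2) / K1 ^ 2) * (w x * Y4 x) +
        (((4 * ηc ^ 2 * cq * a₀' * Λ₁ * Λ₁) * φ2) / K1 ^ 2) * (w x * E x) := fun x => by ring
    simp_rw [e]
    exact (((((((i00.const_mul _).add (i02.const_mul _)).add (i04.const_mul _)).add (i1.const_mul _)).add (i2.const_mul _)).add
      (i3.const_mul _)).add (i4.const_mul _)).add (iE.const_mul _)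
  have hmono := integral_mono_of_nonneg (μ := μ) (ae_of_all _ fun x => (hΦ x).1) hint (ae_of_all _ fun x => (hΦ x).2.trans (hpt x))
  exact hmono.trans (le_of_eq hlin)

end Summit.QuantumFields.YangMills.Theorems.FemtoTransferGap.TwoLattice.ConstTube

end
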